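/-
Copyright: the b2b-balaban T⁴-continuum CRUX team, row NE7b OWNER lineage `t4-ne7b-p1` (gen 148). Project licence.
-/
import Summits.QuantumFields.BalabanUV.T4Continuum.Spine.NE7b.SupTorusBlockDistance

/-!
# THE TORUS INSTANCE OF THE WEIGHTED TRANSPORT'S GEOMETRY: FIBRES, BLOCK GEOMETRY, BLOCK FACTOR, SITE LETTERS — PERIOD-FREE
# (SCOPING-d19 §D (2), geometric half on the road's carriers; file (786)).  The weighted transport and one-step files ((766)–(783)) take
# three geometric data abstractly: a block map `β` with fibres of `≤ n_blk` sites (`hfib`), a coarse weight dominated through `β` by the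
# fine one (`hϑc : ϑc(βx,βx′) ≤ M·ϑ(x,x′)`), and the geometry letters (period-free lattice sums of the weights); (784)∕(785) priced them
# (`T_m = |t|^m·n_blk·M^{m(m−1)∕2}`, `M = e^{ν₂c}` from `d′ ≤ d∕L + c`).  THIS FILE DISCHARGES all three on the road's tori — fine torus
# `Site d ((n+1)s) = (ℤ∕(n+1)s)^d` over the coarse torus `Site d s`, blocks of side `L = n+1`, the torus block map WRITTEN OUT as
# `x ↦ siteOf d s (blk n (windowMap d ((n+1)s) x))` (TDF), the `ℓ¹` circular distance `ρ_N(x,x′) = Σ_i |valMinAbs(x_i − x′_i)|` ((132)),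
# weights `ϑ = e^{νρ_{(n+1)s}}` (fine), `ϑc = e^{ν₂ρ_s}` (coarse):
#   (i) every fibre has EXACTLY `(n+1)^d` sites;  (ii) `ρ_s(βx,βx′) ≤ ρ_{(n+1)s}(x,x′)∕(n+1) + d·n∕(n+1)` (block constant `c = dn∕(n+1) < d`);
#   (iii) `0 ≤ ν₂ ≤ (n+1)ν ⟹ ϑc(βx,βx′) ≤ e^{ν₂·dn∕(n+1)}·ϑ(x,x′)` (`M = e^{ν₂dn∕(n+1)}`);  (iv) `Σ_{y′} e^{aρ_s}·(e^{bρ_s})⁻¹ ≤ (2∕(1−e^{−(b−a)}))^d`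
#   for `a < b`, every period (the geometry letters' profile)
# (row NE7b, node U5c; TDF `siteOf_chart_injective∕surjective`, `blockOf_siteOf`, (132) `fine_coarse_compare`, `torus_sum_exp_le` BY NAME;
# [folklore]).

Cell `pub-balaban`, sub-cell `t4`, spine estimate NE7b (`T4WeightBudget.RelWeightBound`; the cell's OWN estimate — NOT PRINTED in
[Bałaban 1983–89], NOT PROVED).  Crux-route work under `Spine/NE7b/` by the row OWNER (`t4-ne7b-p1` gen 148, file (786)) under FREEZE
(0)'s crux-prover clause; NOTHING of Bałaban's is named as a Lean object, valued or asserted; no `T4Continuum/Support` leaf typed; no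
`def`, no notation (block map, distances and weights WRITTEN OUT); zero `sorry`.  Imports (BY NAME): the OWNER's (132)
`…SupTorusBlockDistance` (`fine_coarse_compare`, `torus_sum_exp_le`, `isPseudoDist_torus`; through it TDF `…SupTorusDirichletForm`
(`blockOf_siteOf`, `siteOf_chart_injective`, `siteOf_chart_surjective`) and the Literature carriers `Beta.Site∕siteOf∕windowMap`,
`B6QGQLower276.blk∕chart∕blk_chart`).

WHAT IS PROVED ([folklore]; `s ≥ 1`, fine period `(n+1)s`):
* §1 FIBRES: **`fibre_eq_image`** (the fibre of the torus block map over `y` is the block chart's image `{σ(chart n (wm y) z) : z}`),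
  **`fibre_card`** (`= (n+1)^d`), `fibre_card_le` (the transport files' `hfib` with `n_blk = (n+1)^d`).
* §2 BLOCK GEOMETRY: **`torus_block_geometry`** (`ρ_s(βx,βx′) ≤ ρ_{(n+1)s}(x,x′)∕(n+1) + d·n∕(n+1)`).
* §3 BLOCK FACTOR: **`torus_block_factor`** (`0 ≤ ν₂ ≤ (n+1)ν ⟹ e^{ν₂ρ_s(βx,βx′)} ≤ e^{ν₂dn∕(n+1)}·e^{νρ_{(n+1)s}(x,x′)}` — `hϑc`),
  `torus_weight_one_le`, `torus_weight_symm`, `torus_weight_pos` (the coarse weight's `hϑc0`∕`hϑcsymm`∕`≥ 1`).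
* §4 SITE LETTERS: `exp_weight_ratio` (`e^{aρ}(e^{bρ})⁻¹ = e^{−((b−a)ρ)}`), **`torus_weight_letter`** (`a < b ⟹ Σ_{y′} e^{aρ_s(y,y′)}(e^{bρ_s(y,y′)})⁻¹
  ≤ (2(1 − e^{−(b−a)})⁻¹)^d`, every period, every centre).
* §5 toy.

HONEST (what this is NOT).  Lattice bookkeeping: the three geometric hypotheses of the weighted transport are theorems on the road's
tori with `n_blk = (n+1)^d`, `M = e^{ν₂dn∕(n+1)}`, letters `(2∕(1−e^{−gap}))^d`; the `ℓ¹` circular distance (equivalent to `ℓ^∞` up to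
`d`); the analytic hypotheses of the class (kernel letters of `U`, factor letters of `A`) are untouched; the cross coefficient and the
relevant∕marginal flow ((784) §4) untouched; scalar skeleton ((A3), NC-NE7b-α UNRULED); nothing of Bałaban's asserted.  BY-NAME EFFECT
ON THE WALL: NONE.  NE7b NOT PRINTED ∕ NOT PROVED; spine PROVED 0∕9; rung (B)+1 — the programme's measures remain FINITE-torus statements;
NOT the mass gap, NOT Clay.  HONEST DEPENDENCY: continuum YM on T⁴ ⇐ BetaPertH ∧ nine spine estimates (0∕9 proved); BetaPertH ⇐ (D1) ∧
(D4) ∧ CAP+tail; G-an2-4 gates asym, D1 and NE2∕3∕4.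
-/

set_option autoImplicit false

noncomputable section

namespace Summit.QuantumFields.BalabanUV.T4Continuum.NE7b.SupWeightedTorusInstance

open Real
open Literature.MathematicalPhysics.QuantumFieldTheory.Balaban1983to89
open B6QGQLower276 (X blk chart blk_chart)
open Beta (Site siteOf windowMap siteOf_windowMap)
open SupTorusDirichletForm (blockOf_siteOf siteOf_chart_injective siteOf_chart_surjective)
open SupTorusBlockDistance (fine_coarse_compare torus_sum_exp_le isPseudoDist_torus)

variable {d : ℕ}

/-! ## §1. The fibres of the torus block map have exactly `(n+1)^d` sites -/

section Fibres

variable (n s : ℕ) [NeZero s]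

/-- The torus block of a block-chart site: `β(σ(chart n (wm y) z)) = y`. [folklore] -/
theorem block_of_chart (y : Site d s) (z : Fin d → Fin (n + 1)) :
    siteOf d s (blk n (windowMap d ((n + 1) * s) (siteOf d ((n + 1) * s) (chart n (windowMap d s y) z)))) = y := by
  simp only [blockOf_siteOf, blk_chart, siteOf_windowMap]

/-- **THE FIBRE OF THE TORUS BLOCK MAP OVER `y` IS THE BLOCK CHART'S IMAGE** `{σ(chart n (wm y) z) : z ∈ (Fin (n+1))^d}`. [folklore] -/
theorem fibre_eq_image (y : Site d s) :
    (Finset.univ.filter fun x : Site d ((n + 1) * s) => siteOf d s (blk n (windowMap d ((n + 1) * s) x)) = y)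
      = Finset.univ.image (fun z : Fin d → Fin (n + 1) => siteOf d ((n + 1) * s) (chart n (windowMap d s y) z)) := by
  ext x
  simp only [Finset.mem_filter, Finset.mem_univ, true_and, Finset.mem_image]
  constructor
  · intro hx
    obtain ⟨⟨y', z⟩, rfl⟩ := siteOf_chart_surjective n s x
    have hy : y' = y := by simpa only [blockOf_siteOf, blk_chart, siteOf_windowMap] using hx
    subst hy
    exact ⟨z, rfl⟩
  · rintro ⟨z, rfl⟩
    exact block_of_chart n s y z

/-- **EVERY FIBRE HAS EXACTLY `(n+1)^d` SITES**. [folklore] -/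
theorem fibre_card (y : Site d s) :
    (Finset.univ.filter fun x : Site d ((n + 1) * s) => siteOf d s (blk n (windowMap d ((n + 1) * s) x)) = y).card = (n + 1) ^ d := by
  rw [fibre_eq_image n s y, Finset.card_image_of_injective]
  · rw [Finset.card_univ, Fintype.card_fun, Fintype.card_fin, Fintype.card_fin]
  · intro z z' h
    have e := siteOf_chart_injective n s (a₁ := (y, z)) (a₂ := (y, z')) h
    exact congrArg Prod.snd e

/-- The transport files' `hfib` on the torus: fibres of `≤ (n+1)^d` sites. [folklore] -/
theorem fibre_card_le (y : Site d s) :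
    (Finset.univ.filter fun x : Site d ((n + 1) * s) => siteOf d s (blk n (windowMap d ((n + 1) * s) x)) = y).card ≤ (n + 1) ^ d :=
  (fibre_card n s y).le

end Fibres

/-! ## §2. The block geometry: blocking by `n+1` contracts the circular distance up to `d·n∕(n+1)` -/

section Geometry

variable (n s : ℕ) [NeZero s]

/-- **THE BLOCK GEOMETRY OF THE TORI**: `ρ_s(βx, βx′) ≤ ρ_{(n+1)s}(x, x′)∕(n+1) + d·n∕(n+1)` for all fine sites `x, x′` ((132)'s lower
comparison read through the block chart). [folklore] -/
theorem torus_block_geometry (x x' : Site d ((n + 1) * s)) :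
    (∑ i, ((((siteOf d s (blk n (windowMap d ((n + 1) * s) x))) i
        - (siteOf d s (blk n (windowMap d ((n + 1) * s) x'))) i).valMinAbs.natAbs : ℕ) : ℝ))
      ≤ (∑ i, (((x i - x' i).valMinAbs.natAbs : ℕ) : ℝ)) / ((n : ℝ) + 1) + (d : ℝ) * n / ((n : ℝ) + 1) := by
  obtain ⟨⟨y, z⟩, rfl⟩ := siteOf_chart_surjective n s x
  obtain ⟨⟨y', z'⟩, rfl⟩ := siteOf_chart_surjective n s x'
  simp only [blockOf_siteOf, blk_chart, siteOf_windowMap]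
  have h := (fine_coarse_compare n s y y' z z').1
  have hn : (0 : ℝ) < (n : ℝ) + 1 := by positivity
  rw [← add_div, le_div_iff₀ hn]
  linarith

end Geometry

/-! ## §3. The block factor of the torus weights and the coarse weight's algebra -/

section Weights

variable (n s : ℕ) [NeZero s]

/-- **THE BLOCK FACTOR ON THE TORI** (the transport files' `hϑc`): with fine weight `e^{νρ_{(n+1)s}}` and coarse weight `e^{ν₂ρ_s}`,
`0 ≤ ν₂ ≤ (n+1)·ν ⟹ e^{ν₂ρ_s(βx,βx′)} ≤ e^{ν₂·dn∕(n+1)}·e^{νρ_{(n+1)s}(x,x′)}` — `M = e^{ν₂dn∕(n+1)} ≤ e^{ν₂d}`. [folklore] -/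
theorem torus_block_factor {ν ν₂ : ℝ} (hν₂ : 0 ≤ ν₂) (hrate : ν₂ ≤ ((n : ℝ) + 1) * ν) (x x' : Site d ((n + 1) * s)) :
    Real.exp (ν₂ * ∑ i, ((((siteOf d s (blk n (windowMap d ((n + 1) * s) x))) i
        - (siteOf d s (blk n (windowMap d ((n + 1) * s) x'))) i).valMinAbs.natAbs : ℕ) : ℝ))
      ≤ Real.exp (ν₂ * ((d : ℝ) * n / ((n : ℝ) + 1))) * Real.exp (ν * ∑ i, (((x i - x' i).valMinAbs.natAbs : ℕ) : ℝ)) := by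
  rw [← Real.exp_add, Real.exp_le_exp]
  have hn : (0 : ℝ) < (n : ℝ) + 1 := by positivity
  have hρ : (0 : ℝ) ≤ ∑ i, (((x i - x' i).valMinAbs.natAbs : ℕ) : ℝ) := Finset.sum_nonneg fun _ _ => Nat.cast_nonneg _
  have hg := torus_block_geometry n s x x'
  have h1 := (mul_le_mul_of_nonneg_left hg hν₂).trans_eq (mul_add _ _ _)
  have h2 : ν₂ * ((∑ i, (((x i - x' i).valMinAbs.natAbs : ℕ) : ℝ)) / ((n : ℝ) + 1))
      ≤ ν * ∑ i, (((x i - x' i).valMinAbs.natAbs : ℕ) : ℝ) := by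
    rw [mul_div_assoc', div_le_iff₀ hn]
    calc ν₂ * ∑ i, (((x i - x' i).valMinAbs.natAbs : ℕ) : ℝ)
        ≤ ((n : ℝ) + 1) * ν * ∑ i, (((x i - x' i).valMinAbs.natAbs : ℕ) : ℝ) := mul_le_mul_of_nonneg_right hrate hρ
      _ = ν * (∑ i, (((x i - x' i).valMinAbs.natAbs : ℕ) : ℝ)) * ((n : ℝ) + 1) := by ring
  linarith

/-- The block factor is at most `e^{ν₂d}` (`ν₂ ≥ 0`). [folklore] -/
theorem torus_blockFactor_le {ν₂ : ℝ} (hν₂ : 0 ≤ ν₂) :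
    Real.exp (ν₂ * ((d : ℝ) * n / ((n : ℝ) + 1))) ≤ Real.exp (ν₂ * d) := by
  rw [Real.exp_le_exp]
  refine mul_le_mul_of_nonneg_left ?_ hν₂
  have hn : (0 : ℝ) < (n : ℝ) + 1 := by positivity
  rw [div_le_iff₀ hn]
  nlinarith [Nat.cast_nonneg (α := ℝ) d, Nat.cast_nonneg (α := ℝ) n]

omit [NeZero s] in
/-- The coarse weight is at least one (`hϑc1`; `ν₂ ≥ 0`). [folklore] -/
theorem torus_weight_one_le {ν₂ : ℝ} (hν₂ : 0 ≤ ν₂) (y y' : Site d s) :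
    1 ≤ Real.exp (ν₂ * ∑ i, (((y i - y' i).valMinAbs.natAbs : ℕ) : ℝ)) :=
  Real.one_le_exp (mul_nonneg hν₂ (Finset.sum_nonneg fun _ _ => Nat.cast_nonneg _))

omit [NeZero s] in
/-- The coarse weight is positive (`hϑc0`). [folklore] -/
theorem torus_weight_pos (ν₂ : ℝ) (y y' : Site d s) : 0 < Real.exp (ν₂ * ∑ i, (((y i - y' i).valMinAbs.natAbs : ℕ) : ℝ)) :=
  Real.exp_pos _

omit [NeZero s] in
/-- The coarse weight is symmetric (`hϑcsymm`). [folklore] -/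
theorem torus_weight_symm (ν₂ : ℝ) (y y' : Site d s) :
    Real.exp (ν₂ * ∑ i, (((y i - y' i).valMinAbs.natAbs : ℕ) : ℝ)) = Real.exp (ν₂ * ∑ i, (((y' i - y i).valMinAbs.natAbs : ℕ) : ℝ)) := by
  rw [(isPseudoDist_torus (d := d) (s := s)).symm y y']

end Weights

/-! ## §4. The site letters of the torus weights, uniformly in the period -/

section Letters

variable (s : ℕ) [NeZero s]

/-- A ratio of exponential weights is an exponential of the rate gap. [folklore] -/
theorem exp_weight_ratio (a b ρ : ℝ) : Real.exp (a * ρ) * (Real.exp (b * ρ))⁻¹ = Real.exp (-((b - a) * ρ)) := by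
  rw [← Real.exp_neg, ← Real.exp_add]
  congr 1
  ring

/-- **THE SITE LETTERS OF THE TORUS WEIGHTS ARE PERIOD-FREE**: for rates `a < b`,
`Σ_{y′} e^{aρ_s(y,y′)}·(e^{bρ_s(y,y′)})⁻¹ ≤ (2(1 − e^{−(b−a)})⁻¹)^d` on every torus `(ℤ∕s)^d`, every centre `y` ((132) §4). [folklore] -/
theorem torus_weight_letter {a b : ℝ} (hab : a < b) (y : Site d s) :
    ∑ y' : Site d s, Real.exp (a * ∑ i, (((y i - y' i).valMinAbs.natAbs : ℕ) : ℝ))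
        * (Real.exp (b * ∑ i, (((y i - y' i).valMinAbs.natAbs : ℕ) : ℝ)))⁻¹ ≤ (2 * (1 - Real.exp (-(b - a)))⁻¹) ^ d := by
  simp only [exp_weight_ratio]
  exact torus_sum_exp_le s (sub_pos.mpr hab) y

end Letters

/-! ## §5. Toy -/

/-- Toy (the block constant in numbers): at `d = 4`, `n = 1` (blocks of side 2) the block constant is `4·1∕2 = 2 < 4`. -/
example : (4 : ℝ) * 1 / (1 + 1) = 2 := by norm_num

end Summit.QuantumFields.BalabanUV.T4Continuum.NE7b.SupWeightedTorusInstance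

end
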